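import Summits.CriticalPhenomena.SAWScalingLimit.Theses.SAWLeftRightFKG
import Summits.CriticalPhenomena.SAWScalingLimit.Theorems.FKGToTraversalBound.Negative.DeepEndpointGap
import Literature.Probability.LatticeModels.DirichletGreenFunction

/-!
# Line `excursion-domination` — skeleton for crux `FKGToTraversalBound` (stmt-CriticalPhenomena-1878)

Crux (route `SAWLeftRightFKG`, rank 3): `FKGToTraversalBound := LeftRightFKG → SAWTraversalBound`
(`Iff.rfl`, Disproof §1 `iff_imp`): left–right positive association (PA) of the critical square-lattice
SAW chord measure in every r2 domain `Ω = {wind(C,·) ≠ 0}` between boundary-adjacent endpoints should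
give the Aizenman–Burchard hypothesis (H1) (shell-dependent threshold) for every Dobrushin domain and
every endpoint approximation.  By Disproof F1 (`mono_hyp`) every proof is `PA → P` and `P → (H1)` for a
consequence `P` of PA; here `P` = EXCURSION DOMINATION.

Idea (card `Ideas/excursion-domination.md`, triage r1-1/2/3: pass ×3, "could not break"): compare the
chord with the KILLED RANDOM WALK, not with itself.  `ED(C)`: in every r2 domain, for every finite set
`H` of sites whose avoidance event is ONE-SIDED (down- or up-closed in the route's left–right order `≼`),
`P_SAW(avoid H) ≥ (G_{Λ∖H}(a,b)/G_Λ(a,b))^C` — the lattice shadow of the restriction exponents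
`5/8 ≤ 1` (`P_{SLE_{8/3}}(avoid A) = Φ'_A^{5/8} ≥ Φ'_A = P_exc(avoid A)`, tree
`IsRestrictionMeasure.measure_avoid_excHull`).  Both sides are exact multiplicative cocycles in `H`,
and the right-hand side is discrete potential theory, where rough walls are harmless.

How the line reaches (H1) — the four registered stubs and the proved glue:

* `stub_excursionDomination : LeftRightFKG → ExcursionDominationIneq` — the card's conjecture; PA enters
  through the card's step (3) (exact cocycle ⇒ one boundary site; PA/sandwich monotonicity of one-site
  hitting probabilities ⇒ extremal local geometries).  HARDEST.
* `stub_rwCollarBound : RWCollarBound` — the ε-source: behind a lattice COLLAR of modulus `M` (sites of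
  `Λ` in a closed annulus `r ≤ |δx − z₀| ≤ R`, `R ≥ M r`, separating a dead end `Far` from the component
  `Near ∋ a, b`), the killed-walk excursion from `a` to `b` avoids the dead end with probability `≥ η`:
  `η G_Λ(a,b) ≤ G_{Λ∖H}(a,b)` for `H ⊆ Far`.  Printed-grade (Kemppainen–Smirnov 2017 Prop. 4.11 /
  Thm. 4.12 for chordal LERW = exactly this estimate for quads; tree: `weakBeurling_of_cutPath`,
  `latticeHM_compl_sqBox_le_of_cutPath`, `harnack_one_scale`, `dirichletGreen` API).
* `sawCollarBound_of` (PROVED here): ED + RW collar bound ⇒ `SAWCollarBound` — the critical chord avoids a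
  one-sided dead end behind a collar of modulus `M` with probability `≥ η^C`, uniformly in the domain.
  This is the uniform pocket lemma every line of this crux needs, with the rough-wall uniformity moved
  to harmonic measure.
* `stub_shellIteration : SAWCollarBound → GoodShellTight` — the Kemppainen–Smirnov iteration on the
  lattice for GOOD (eventually PRESENTABLE) endpoint approximations: exact domain Markov property
  (future after a lattice stopping time = `x_c`-SAW of the presented slit domain `dom C'`, `C'` = the
  boundary walk spliced with the past out-and-back, Disproof §6 / free-loop lemma), dead ends behind
  avoidable monochromatic components are one-sided (lattice crosscut lemma) and collared off
  (`IsCollaredOff`), nesting over `k` concentric collars gives unforced-crossing probability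
  `≤ (1-η^C)^k < 1/4`, then KS17 Lemma 3.6 (index of the past, `±1` steps) and the counting of
  Prop. 3.5 with a `δ`-uniform forced count `n₀(shell)` (Jordan ULC, `JordanDomain.exists_modulus`)
  give PER-SHELL TIGHTNESS of the traversal counts for shells of modulus `≥ M'`.  XL but charted.
* `stub_residualShells : ResidualShellTight` — per-shell tightness for the endpoint approximations that
  are NOT eventually presentable: the deep-endpoint fragment of Disproof F3 (`IsEndpointApprox` admits
  starts/targets at lattice depth `→ ∞`, `exists_isEndpointApprox_deepStart`; PA is not instantiable
  there, `not_presentable_of_enclosed`, and KS-G2 itself fails for floating pasts, triage X1/S1/P1) and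
  the rough-boundary fragment F3(c) (`discreteDomainGraph D δ` not an induced subgraph).  NOT this line's
  mechanism (shared residue of every line of this crux; tenure may restate the crux on class R1).
* `traversalBound_of_shellTight` (PROVED here, triage X2): per-shell tightness for shells of modulus
  `≥ M` ⇒ `SAWTraversalBound` with `K = M³`, `λ = 3` (small-modulus shells are free: `K (ρ/R)³ ≥ 1`),
  and `FKGToTraversalBound_of` concludes the crux BY NAME (case split Good / not Good).

Disproof used: F1 (`mono_hyp` shape, no `_false_without_` exists); F3 (the Good class is defined by
presentability with BOTH endpoints adjacent to the presenting walk — exactly where `LeftRightFKG` /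
ED can be instantiated; the complement is the separate `stub_residualShells`, never fed to ED); §6
`noFloatingHoles` (every non-domain neighbour of a domain site lies ON `C`: dead ends touch `C` and are
shoreline-peelable; presented slit domains stay in the r2 class); F4 (the η comes from harmonic measure,
not from corridor energetics).  No landed Negative lemma (`Theorems/FKGToTraversalBound/Negative/
DeepEndpointGap.lean`, imported) refutes an instance of a stub: `not_PAClause_of_two_maximal` concerns
deep–deep carriers, which are outside `GoodApprox`; negatives index: stmt-0772 (all-δ tightness) —
every statement here keeps `∃ δ₀` after `(D, a, b)`.

`sorry` occurs only in the four `stub_*` theorems.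
-/

noncomputable section

open MeasureTheory Filter Topology Set Metric
open scoped NNReal ENNReal
open Literature.Probability.LatticeModels
open Literature.Probability.RandomPlanarGeometry
open Literature.Probability.RandomPlanarGeometry.SAW
open Summit.CriticalPhenomena.SAWScalingLimit.Theses.SAWLeftRightFKG
open Summit.CriticalPhenomena.SAWScalingLimit.Theorems.FKGToTraversalBound.Negative (dom lrLE)

namespace Summit.CriticalPhenomena.SAWScalingLimit.Cruxes.FKGToTraversalBound.ExcursionDomination

/-! ## Vocabulary of the line -/

section Vocabulary

variable {Ω : Set ℂ} {δ : ℝ} {a b : Site 2}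

/-- The chords of `Ω_δ` from `a` to `b` that AVOID the set `H` of lattice sites. -/
def Avoid (H : Set (Site 2)) : Set (DomainSAW Ω δ a b) :=
  {γ | ∀ v ∈ γ.walk.support, v ∉ H}

end Vocabulary

/-- A set `S` of chords is ONE-SIDED for the relation `le` (the route's left–right order `≼`):
it is down-closed or up-closed.  For `S = Avoid H` this says `H` behaves like a hull attached to ONE
of the two boundary arcs (lattice crosscut lemma); unions of same-side avoidances are again one-sided
(intersection of down-closed sets). -/
def OneSided {ι : Type*} (le : ι → ι → Prop) (S : Set ι) : Prop :=
  (∀ γ₁ γ₂, le γ₁ γ₂ → γ₂ ∈ S → γ₁ ∈ S) ∨ (∀ γ₁ γ₂, le γ₁ γ₂ → γ₁ ∈ S → γ₂ ∈ S)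

/-- `u` and `v` are joined by a nearest-neighbour lattice path all of whose sites lie in `Λ` and
off `V` (reachability in the induced `ℤ²`-graph on `Λ ∖ V`; reflexive for `u ∈ Λ ∖ V`). -/
def JoinedOff (Λ V : Finset (Site 2)) (u v : Site 2) : Prop :=
  ∃ p : (zdGraph 2).Walk u v, ∀ x ∈ p.support, x ∈ Λ ∧ x ∉ V

/-- **Collar structure** (lattice form of "the set `H` lies in a dead end behind an annulus of
modulus `R/r`", Kemppainen–Smirnov's avoidable quad with monochromatic sides, Def. 2.2 / Lemma 3.6):
there is a COLLAR `V ⊆ Λ` of sites whose mesh points lie in the closed annulus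
`r ≤ |δx − z₀| ≤ R` such that, writing `Near` for the sites joined to `a` in `Λ ∖ V`,
* `b ∈ Near` (the collar is AVOIDABLE: it does not separate `a` from `b`),
* `H` misses `Near` and the collar (so `H` lies in the dead end `Far := Λ ∖ V ∖ Near`, or off `Λ`),
* every `Λ`-edge leaving the collar enters `Near` across the INNER circle and `Far` across the OUTER
  circle — or the other way round (second disjunct),
* and some NON-domain site lies within `r + δ` of the centre (Kemppainen–Smirnov's clause
  `∂B(z₀, r) ∩ ∂U_τ ≠ ∅`, Def. 2.2: the wall that makes Beurling's estimate bite; in an r2 domain every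
  non-domain site is joined to infinity off the domain, `noFloatingHoles`).
In particular `V` is a union of connected components of `Λ ∩ annulus`, its lateral walls are killing,
and every lattice path from `Far` to `Near` traverses the collar radially.  Several dead ends behind the
same annulus are ONE collar structure (take the union of their collars). -/
def IsCollaredOff (Λ : Finset (Site 2)) (a b : Site 2) (δ : ℝ) (z₀ : ℂ) (r R : ℝ)
    (H : Finset (Site 2)) : Prop :=
  ∃ V : Finset (Site 2), V ⊆ Λ ∧
    (∀ x ∈ V, r ≤ dist (meshPoint δ x) z₀ ∧ dist (meshPoint δ x) z₀ ≤ R) ∧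
    JoinedOff Λ V a b ∧
    (∀ y, JoinedOff Λ V a y → y ∉ H) ∧ (∀ x ∈ V, x ∉ H) ∧
    (∃ p : Site 2, p ∉ Λ ∧ dist (meshPoint δ p) z₀ ≤ r + δ) ∧
    ((∀ x ∈ V, ∀ y ∈ Λ, y ∉ V → (zdGraph 2).Adj x y →
        (JoinedOff Λ V a y → dist (meshPoint δ y) z₀ < r) ∧
        (¬ JoinedOff Λ V a y → R < dist (meshPoint δ y) z₀)) ∨
     (∀ x ∈ V, ∀ y ∈ Λ, y ∉ V → (zdGraph 2).Adj x y →
        (JoinedOff Λ V a y → R < dist (meshPoint δ y) z₀) ∧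
        (¬ JoinedOff Λ V a y → dist (meshPoint δ y) z₀ < r)))

/-! ## Statements of the line

All r2-side statements quantify over the binders of `LeftRightFKG` VERBATIM: mesh `δ > 0`, a closed
lattice walk `C` (the boundary; slits allowed), the domain `dom C δ = {z | wind(δ-polyline of C, z) ≠ 0}`
and endpoints `a, b` lattice-adjacent to vertices `a', b'` of `C`; `lrLE` is the route's order (both from
`Theorems/FKGToTraversalBound/Negative/DeepEndpointGap.lean`, `leftRightFKG_iff_PAClause : … := Iff.rfl`).
`Λ = meshDomain (dom C δ) δ` as a `Finset` through the finiteness binder `hΛ` (the domain is bounded).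
-/

/-- **Excursion domination** `ED` (card `excursion-domination`; conjecture at `x = x_c`, sharp: both
one-site hitting probabilities carry the boundary two-leg exponent `2`).  ONE exponent `C ≥ 1` such that
in every r2 domain, for every finite `H` whose avoidance event is one-sided in `≼`,
`Z_Ω(a,b) · G_{Λ∖H}(a,b)^C ≤ Z_{Ω, avoid H}(a,b) · G_Λ(a,b)^C`, i.e.
`P_SAW(avoid H) ≥ (G_{Λ∖H}(a,b)/G_Λ(a,b))^C = P_{RW-excursion a→b}(avoid H)^C`
(`dirichletGreen`: the walk killed off the site set, weight `4^{-length}`; the ratio is the mass of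
`a → b` paths avoiding `H`).  Junk: `a ∈ H` or `H` separating ⇒ both sides `0`; `H = ∅` ⇒ equality;
`C ≥ 1` excludes the `0^0` artefact (triage r1-1). Evidence: 150 + 74 exact (box, hull) pairs, all
exponents `log P_SAW/log P_RW ∈ [0.69, 1.06]`, decreasing in the size (card D2, triage r1-2); corridor
families `→ Δs/Δq ∈ {0.906, 0.752, 0.848}` and `→ 5/8` (triage r1-1 §G3). -/
def ExcursionDominationIneq : Prop :=
  ∃ Cexp : ℕ, 1 ≤ Cexp ∧ ∀ (δ : ℝ) (c a b a' b' : Site 2) (C : (zdGraph 2).Walk c c),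
    0 < δ → a' ∈ C.support → b' ∈ C.support → (zdGraph 2).Adj a a' → (zdGraph 2).Adj b b' →
    ∀ (H : Finset (Site 2)) (hΛ : (meshDomain (dom C δ) δ).Finite),
      OneSided (lrLE (Ω := dom C δ) (δ := δ) (a := a) (b := b))
        (Avoid (H : Set (Site 2)) : Set (DomainSAW (dom C δ) δ a b)) →
      weight (dom C δ) δ a b Set.univ *
          ENNReal.ofReal (dirichletGreen (hΛ.toFinset \ H) a b ^ Cexp) ≤
        weight (dom C δ) δ a b (Avoid (H : Set (Site 2))) *
          ENNReal.ofReal (dirichletGreen hΛ.toFinset a b ^ Cexp)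

/-- **Random-walk collar bound** (dead-end estimate for the killed walk; the line's ε-source).
There are `M > 1` and `η > 0` such that in every r2 domain, for every annulus `r ≤ |z − z₀| ≤ R` with
`δ ≤ r` and `M r ≤ R` and every `H` collared off from `a, b` by it, the Green function does not drop
by more than the factor `η` when `H` is removed: `η G_Λ(a,b) ≤ G_{Λ∖H}(a,b)` (and `G_Λ(a,b) > 0`:
`a, b` are joined in `Λ`).  Equivalently the `a → b` excursion of the walk killed off `Λ` enters the
dead end behind a collar of modulus `M` with probability `≤ 1 - η`, uniformly in the roughness of the
walls.  Kemppainen–Smirnov 2017, Prop. 4.11 + proof of Thm. 4.12 (chordal LERW: the conditioned walk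
reaches the far side of a dead-end boundary quad of extremal length `≥ L₀` with probability
`≤ 1 - ε₀/4`), transplanted from quads to round collars; ingredients in tree and PROVED: weak Beurling
(`weakBeurling_of_cutPath`, `latticeHM_compl_sqBox_le_of_cutPath`; the cut path is `Near ∪ C ∪`
exterior, connected to infinity by `noFloatingHoles`), one-scale Harnack (`harnack_one_scale`),
`dirichletGreen` / `poissonKernel` / `green_representation`. -/
def RWCollarBound : Prop :=
  ∃ (M η : ℝ), 1 < M ∧ 0 < η ∧ ∀ (δ : ℝ) (c a b a' b' : Site 2) (C : (zdGraph 2).Walk c c),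
    0 < δ → a' ∈ C.support → b' ∈ C.support → (zdGraph 2).Adj a a' → (zdGraph 2).Adj b b' →
    ∀ (hΛ : (meshDomain (dom C δ) δ).Finite) (z₀ : ℂ) (r R : ℝ) (H : Finset (Site 2)),
      δ ≤ r → M * r ≤ R → IsCollaredOff hΛ.toFinset a b δ z₀ r R H →
      0 < dirichletGreen hΛ.toFinset a b ∧
        η * dirichletGreen hΛ.toFinset a b ≤ dirichletGreen (hΛ.toFinset \ H) a b

/-- **SAW collar bound** (the uniform pocket lemma, DERIVED below from ED and the random-walk collar
bound): there are `M > 1`, `η > 0` such that in every r2 domain the critical chord avoids every ONE-SIDED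
set `H` collared off by an annulus of modulus `M` (`δ ≤ r`, `M r ≤ R`) with probability `≥ η`:
`η · Z_Ω(a,b) ≤ Z_{Ω, avoid H}(a,b)`.  Uniform in the domain, the past (any presented slit domain is an
r2 domain) and the mesh. -/
def SAWCollarBound : Prop :=
  ∃ (M η : ℝ), 1 < M ∧ 0 < η ∧ ∀ (δ : ℝ) (c a b a' b' : Site 2) (C : (zdGraph 2).Walk c c),
    0 < δ → a' ∈ C.support → b' ∈ C.support → (zdGraph 2).Adj a a' → (zdGraph 2).Adj b b' →
    ∀ (hΛ : (meshDomain (dom C δ) δ).Finite) (z₀ : ℂ) (r R : ℝ) (H : Finset (Site 2)),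
      δ ≤ r → M * r ≤ R → IsCollaredOff hΛ.toFinset a b δ z₀ r R H →
      OneSided (lrLE (Ω := dom C δ) (δ := δ) (a := a) (b := b))
        (Avoid (H : Set (Site 2)) : Set (DomainSAW (dom C δ) δ a b)) →
      ENNReal.ofReal η * weight (dom C δ) δ a b Set.univ ≤
        weight (dom C δ) δ a b (Avoid (H : Set (Site 2)))

/-- **Per-shell tightness of the traversal counts** for the shells of modulus `≥ M` (triage X2: this
is all that (H1) with a shell-dependent threshold asks): one `δ₀ > 0` for the endpoint approximation,
and for every shell `D(x; ρ, R)` with `M ρ ≤ R ≤ 1` and every `ε > 0` a threshold `n` with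
`P_δ(n separate traversals of D(x; ρ, R)) ≤ ε` for all meshes `δ ≤ δ₀` with `δ ≤ ρ`.
(`n` may absorb any `δ`-uniform forced count; no rate in `ρ/R`, no uniformity across shells.) -/
def ShellTight (M : ℝ) (D : DobrushinDomain) (a b : ℝ → Site 2) : Prop :=
  ∃ δ₀ : ℝ, 0 < δ₀ ∧ ∀ (x : ℂ) (ρ R : ℝ), 0 < ρ → M * ρ ≤ R → R ≤ 1 → ∀ ε : ℝ, 0 < ε → ∃ n : ℕ,
    ∀ δ ∈ Set.Ioc (0 : ℝ) δ₀, δ ≤ ρ →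
      law D.carrier δ (a δ) (b δ)
          {γ | (⟨γ.walk.toCurve (meshPoint δ)⟩ : Curve ℂ).HasTraversals n x ρ R} ≤
        ENNReal.ofReal ε

/-- The lattice domain `D_δ` with endpoints `u, v` is **presentable** as an instance of `LeftRightFKG`:
some closed lattice walk `C` has `discreteDomainGraph (dom C δ) δ = discreteDomainGraph D.carrier δ`
(same sites in the largest component, same edges — r2 domains are induced subgraphs, Disproof F3(c)),
and `u, v` are lattice-adjacent to vertices of `C` (Disproof F3(a): BOTH endpoints boundary-adjacent).
For smooth `D` at small mesh this is the class R1 (`u, v ∈ meshBoundary`): take for `C` the outer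
vertex contour of `D_δ`. -/
def Presentable (D : DobrushinDomain) (δ : ℝ) (u v : Site 2) : Prop :=
  ∃ (c u' v' : Site 2) (C : (zdGraph 2).Walk c c), u' ∈ C.support ∧ v' ∈ C.support ∧
    (zdGraph 2).Adj u u' ∧ (zdGraph 2).Adj v v' ∧
    discreteDomainGraph D.carrier δ = discreteDomainGraph (dom C δ) δ

/-- **Good endpoint approximations**: presentable for all small meshes.  The complement contains the
deep-endpoint approximations of Disproof F3 / `exists_isEndpointApprox_deepStart` and the rough
(non-induced) discretisations of F3(c). -/
def GoodApprox (D : DobrushinDomain) (a b : ℝ → Site 2) : Prop :=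
  ∃ δ₁ : ℝ, 0 < δ₁ ∧ ∀ δ ∈ Set.Ioc (0 : ℝ) δ₁, Presentable D δ (a δ) (b δ)

/-- Output of the iteration: per-shell tightness at some modulus `M > 1` for all GOOD approximations. -/
def GoodShellTight : Prop :=
  ∃ M : ℝ, 1 < M ∧ ∀ (D : DobrushinDomain) (a b : ℝ → Site 2),
    IsEndpointApprox D a b → GoodApprox D a b → ShellTight M D a b

/-- The residual fragment: per-shell tightness (every modulus `M > 1`, i.e. every genuine shell) for
the endpoint approximations that are NOT good (deep endpoints, rough discretisations). -/
def ResidualShellTight : Prop :=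
  ∀ M : ℝ, 1 < M → ∀ (D : DobrushinDomain) (a b : ℝ → Site 2),
    IsEndpointApprox D a b → ¬ GoodApprox D a b → ShellTight M D a b

/-! ## Stubs (registered; `sorry` only here) -/

/-- STUB 1 (HARDEST; the card's conjecture) — **left–right PA ⇒ excursion domination.**
Intended route (card, step (3)): (i) both sides are EXACT multiplicative cocycles under
`H ↦ H₁ ∪ H₂` (`Z_{Ω∖(H₁∪H₂)}/Z_Ω = (Z_{Ω∖H₁}/Z_Ω)(Z_{Ω∖H₁∖H₂}/Z_{Ω∖H₁})` by exact restriction of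
the `x_c`-weights; the same telescoping for `dirichletGreen`), and a dead end touching `C` is
shoreline-peelable through r2 domains (`noFloatingHoles`: each removed site is adjacent to the current
boundary walk, extend it out-and-back) — so for the CONSUMED sets (`SAWCollarBound`) ED reduces to ONE
boundary-adjacent site `y`: `1 − P_SAW(γ ∋ y) ≥ (1 − P_RW(ω ∋ y))^C`; (ii) `LeftRightFKG` (through the
sandwich inequality `w(D ∩ U) w(univ) ≤ w(D) w(U)`, triage X3) makes the one-site hitting probability
monotone under carving the opposite arc / filling the same arc, reducing to extremal local geometries
(flat wall, convex corner, slit tip); (iii) the one-site inequality there: both one-site probabilities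
scale as `δ² × (the same conformal factor)` — boundary two-leg exponent `2` on both sides — so only a
constant is at stake.  A PA-free proof also closes the stub (`mono_hyp`).  Cheapest falsifier (triage
r1-1/3 sharpen): a FAMILY with `log P_SAW(avoid y)/log P_RW(avoid y) → ∞` — strip transfer matrices
with a far corner site, widths `≤ 10` — before investing. Size XL / open. -/
theorem stub_excursionDomination : LeftRightFKG → ExcursionDominationIneq := by
  sorry

/-- STUB 2 (L; classical potential theory, printed-grade) — **the killed walk rarely explores a dead
end behind a collar.**  Scheme (KS17 Prop. 4.11 / Thm. 4.12): a path `a → b` through `H` traverses the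
collar twice, and its return trip must travel inside `V ∪ Far` between the two rims of the collar, i.e.
from distance `≥ R − δ` to distance `≤ r + δ` of `z₀` (or outward, second orientation) AVOIDING the cut
set `K := Near ∪ (ℤ² ∖ Λ)`, which contains a lattice path from the non-domain site `p` near `z₀` to
infinity (`noFloatingHoles` along `C`; `Near ∋ a ∼ a' ∈ C`): weak Beurling (`weakBeurling_of_cutPath` /
`latticeHM_compl_sqBox_le_of_cutPath`, exterior form by reversal `dirichletGreen_comm`) makes that
factor `≤ c M^{-β}`; Harnack / maximum principle (`harnack_one_scale`, `le_add_mul_latticeHM`) and the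
last-exit decomposition compare `G_Λ(·, b)` on the far rim with the values met on the way out (KS17
p. 28: `max_{S₂} P_x(b) ≤ ½ min_B P_y(b)`); `G_Λ(a,b) > 0` by `JoinedOff Λ V a b`.  `δ ≤ r` keeps the
collar at lattice scale; `M` large absorbs all constants, `η` small. -/
theorem stub_rwCollarBound : RWCollarBound := by
  sorry

/-- STUB 3 (XL, charted: the Kemppainen–Smirnov iteration for ONE curve with an exact domain Markov
property, on the lattice) — **SAW collar bound ⇒ per-shell tightness for good approximations.**
Chart: (a) DOMAIN MARKOV: for a prefix `π` of the SAW (a lattice stopping time), the conditional law of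
the future is `SAW.law (dom C') δ tip (b δ)` for the spliced closed walk
`C' = C · (a' → a δ → π minus tip → back)` plus out-and-back detours killing the pockets sealed by `π`
(zero winding added; `noFloatingHoles`; transport of `DomainSAW` along the graph equality of
`Presentable` by `SimpleGraph.Walk.transfer`); (b) ONE-SIDEDNESS: the sites beyond an avoidable
component of `annulus ∩ (D_δ ∖ π)` with monochromatic walls form a dead end attached to ONE arc of
`C'`, hence `Avoid` of it is one-sided in `lrLE` (lattice crosscut lemma, wind API of
`Topology.PlaneTopology.WindingNumber`, Disproof §6) and `IsCollaredOff` holds with `V` = the component's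
sites (union over all such components of one colour); (c) hence, from `SAWCollarBound` with `(M, η)`:
`P(next sub-annulus crossing is unforced | prefix) ≤ 1 − η`; NESTING over `k` concentric collars of
modulus `M` (KS17 p. 11): an unforced crossing of modulus `M^k` costs `≤ (1-η)^k =: p < 1/4`;
(d) KS17 Lemma 3.6 on the lattice (index of the prefix = minimal number of middle-annulus crossings of
its futures, `±1` per crossing, index-increasing crossings contain unforced ones) and the counting of
Prop. 3.5: `P(n₀ + 2m traversals of D(x; ρ, R)) ≤ 4^m p^m` once `R ≥ M^{3k} ρ`, where the forced
count `n₀(x, ρ, R; D, a, b)` is finite and uniform in `δ ≤ δ₀` (a Jordan curve traverses a genuine shell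
finitely often, `Curve.exists_not_hasTraversals`; uniform local connectedness
`JordanDomain.exists_modulus`; template `Percolation.bondExploration_traversalBound_holds`).
COUNTING CAVEAT (budget for it): the observation times `σ_l` (ends of middle-annulus crossings) are
unbounded in number, so "apply the bound `(n−n₀)/2` times" must be written as an adapted argument —
e.g. the supermartingale `λ^{I_l} θ^l` (`λ = 2`, `θ = (2p + 1/2)^{-1} > 1` for `p < 1/4`) on the index
`I_l` at the times `σ_l`, which needs every index-INCREASING next crossing to enter a dead end that is
collared and one-sided at `σ_l` (KS claim 2 after an increase; a re-entry after a decrease is an entry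
into the pocket just left, again avoidable and monochromatic) — then `P(L ≥ n) ≤ λ^{n₀} θ^{-n}` for the
number `L ≥ N` of middle-annulus crossings, which is all per-shell tightness needs.
Output: `ShellTight (M^{3k})` for every good approximation. -/
theorem stub_shellIteration : SAWCollarBound → GoodShellTight := by
  sorry

/-- STUB 4 (open; NOT this line's mechanism — the shared residue of every line of this crux, Disproof
F3 / triage X1, S1–S2, P1) — **per-shell tightness for the approximations that are never presentable**:
deep marked points (`exists_isEndpointApprox_deepStart`: lattice depth `δ^{-1/2}`; there PA has no
instance, `not_presentable_of_enclosed`, `not_PAClause_of_two_maximal`, and KS-G2 fails for floating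
pasts, two-corridor ring `P → .996`) and rough Jordan boundaries whose discretisation drops edges
(F3(c)).  Needs interior return estimates for the critical SAW (whole-plane 3-arm type, F3 upshot) or
the statement repair R1 at route level (restrict `IsEndpointApprox` to `meshBoundary` endpoints + a
deep-endpoint reduction item) — tenure business; recorded here so that the composition is honest. -/
theorem stub_residualShells : ResidualShellTight := by
  sorry

/-! ## Glue (sorry-free) -/

/-- **ED + random-walk collar bound ⇒ SAW collar bound** with the same modulus `M` and `η' = η^C`:
`Z(univ) · (η G)^C ≤ Z(univ) · G'^C ≤ Z(avoid H) · G^C`, cancel `G^C > 0`. -/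
theorem sawCollarBound_of (hED : ExcursionDominationIneq) (hRW : RWCollarBound) : SAWCollarBound := by
  obtain ⟨Cexp, hC1, hED⟩ := hED
  obtain ⟨M, η, hM, hη, hRW⟩ := hRW
  refine ⟨M, η ^ Cexp, hM, pow_pos hη _, ?_⟩
  intro δ c a b a' b' C hδ ha' hb' haa' hbb' hΛ z₀ r R H hδr hMR hcol hone
  obtain ⟨hGpos, hGge⟩ := hRW δ c a b a' b' C hδ ha' hb' haa' hbb' hΛ z₀ r R H hδr hMR hcol
  have key := hED δ c a b a' b' C hδ ha' hb' haa' hbb' H hΛ hone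
  set G : ℝ := dirichletGreen hΛ.toFinset a b with hG
  set G' : ℝ := dirichletGreen (hΛ.toFinset \ H) a b with hG'
  set Zu := weight (dom C δ) δ a b Set.univ with hZu
  set Za := weight (dom C δ) δ a b (Avoid (H : Set (Site 2))) with hZa
  have hηG : 0 ≤ η * G := by positivity
  have hpow : (η * G) ^ Cexp ≤ G' ^ Cexp := pow_le_pow_left₀ hηG hGge Cexp
  have hsplit : ENNReal.ofReal ((η * G) ^ Cexp) =
      ENNReal.ofReal (η ^ Cexp) * ENNReal.ofReal (G ^ Cexp) := by
    rw [mul_pow, ENNReal.ofReal_mul (pow_nonneg hη.le _)]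
  have hGC : 0 < G ^ Cexp := pow_pos hGpos _
  have h0 : ENNReal.ofReal (G ^ Cexp) ≠ 0 := (ENNReal.ofReal_pos.2 hGC).ne'
  have htop : ENNReal.ofReal (G ^ Cexp) ≠ ⊤ := ENNReal.ofReal_ne_top
  have step : Zu * (ENNReal.ofReal (η ^ Cexp) * ENNReal.ofReal (G ^ Cexp)) ≤
      Za * ENNReal.ofReal (G ^ Cexp) := by
    calc Zu * (ENNReal.ofReal (η ^ Cexp) * ENNReal.ofReal (G ^ Cexp))
        = Zu * ENNReal.ofReal ((η * G) ^ Cexp) := by rw [hsplit]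
      _ ≤ Zu * ENNReal.ofReal (G' ^ Cexp) := by
          gcongr
      _ ≤ Za * ENNReal.ofReal (G ^ Cexp) := key
  have step' : (ENNReal.ofReal (η ^ Cexp) * Zu) * ENNReal.ofReal (G ^ Cexp) ≤
      Za * ENNReal.ofReal (G ^ Cexp) := by
    calc (ENNReal.ofReal (η ^ Cexp) * Zu) * ENNReal.ofReal (G ^ Cexp)
        = Zu * (ENNReal.ofReal (η ^ Cexp) * ENNReal.ofReal (G ^ Cexp)) := by ring
      _ ≤ Za * ENNReal.ofReal (G ^ Cexp) := step
  exact (ENNReal.mul_le_mul_iff_left h0 htop).1 step'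

/-- Whatever the junk conventions, the SAW law gives mass at most `1` to every event. -/
theorem law_le_one (Ω : Set ℂ) (δ : ℝ) (u v : Site 2) (S : Set (DomainSAW Ω δ u v)) :
    law Ω δ u v S ≤ 1 := by
  calc law Ω δ u v S ≤ law Ω δ u v Set.univ := measure_mono (Set.subset_univ _)
    _ = (weight Ω δ u v Set.univ)⁻¹ * weight Ω δ u v Set.univ := by
        rw [law, Measure.smul_apply, smul_eq_mul]
    _ ≤ 1 := ENNReal.inv_mul_le_one _

/-- The target probability `M³ (ρ/R)³` of a shell of modulus `≥ M` is positive. -/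
theorem eps_pos {M ρ R : ℝ} (hM : 1 < M) (hρ : 0 < ρ) (h : M * ρ ≤ R) :
    0 < M ^ 3 * (ρ / R) ^ 3 := by
  have hM0 : 0 < M := by linarith
  have hR : 0 < R := lt_of_lt_of_le (by positivity) h
  positivity

/-- Real power with exponent `3` is the monomial. -/
theorem rpow_three (t : ℝ) : t ^ (3 : ℝ) = t ^ (3 : ℕ) := by
  rw [← Real.rpow_natCast]; norm_num

/-- **Per-shell tightness ⇒ (H1)** (triage X2, proved): with `K = M³`, `λ = 3` and the threshold
`k(x, ρ, R) :=` the `M³(ρ/R)³`-quantile of the traversal count when `M ρ ≤ R ≤ 1` (and `0` otherwise,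
where `K (ρ/R)³ > 1 ≥ law` is free), per-shell tightness at modulus `M` gives `SAWTraversalBound`. -/
theorem traversalBound_of_shellTight {M : ℝ} (hM : 1 < M)
    (h : ∀ (D : DobrushinDomain) (a b : ℝ → Site 2), IsEndpointApprox D a b → ShellTight M D a b) :
    SAWTraversalBound := by
  classical
  intro D a b hab
  obtain ⟨δ₀, hδ₀, H⟩ := h D a b hab
  have hM0 : 0 < M := by linarith
  choose n hn using H
  set k : ℂ → ℝ → ℝ → ℕ := fun x ρ R =>
    if hc : 0 < ρ ∧ M * ρ ≤ R ∧ R ≤ 1 then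
      n x ρ R hc.1 hc.2.1 hc.2.2 (M ^ 3 * (ρ / R) ^ 3) (eps_pos hM hc.1 hc.2.1)
    else 0 with hk
  refine ⟨k, M ^ 3, 3, δ₀, by positivity, by norm_num, hδ₀, ?_⟩
  intro δ hδ x ρ R hδρ hρR hR1
  have hρ : 0 < ρ := hδ.1.trans_le hδρ
  have hR : 0 < R := hρ.trans hρR
  rw [rpow_three]
  by_cases hcase : M * ρ ≤ R
  · have hkx : k x ρ R =
        n x ρ R hρ hcase hR1 (M ^ 3 * (ρ / R) ^ 3) (eps_pos hM hρ hcase) := by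
      simp only [hk, dif_pos (And.intro hρ (And.intro hcase hR1))]
    rw [hkx]
    exact hn x ρ R hρ hcase hR1 _ _ δ hδ hδρ
  · have hcase : R < M * ρ := lt_of_not_ge hcase
    have hbig : (1 : ℝ) ≤ M ^ 3 * (ρ / R) ^ 3 := by
      have h1 : 1 < M * (ρ / R) := by
        rw [mul_div_assoc', lt_div_iff₀ hR]
        linarith
      have h2 : (1 : ℝ) ≤ (M * (ρ / R)) ^ 3 := one_le_pow₀ h1.le
      calc (1 : ℝ) ≤ (M * (ρ / R)) ^ 3 := h2
        _ = M ^ 3 * (ρ / R) ^ 3 := by ring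
    calc law D.carrier δ (a δ) (b δ)
          {γ | (⟨γ.walk.toCurve (meshPoint δ)⟩ : Curve ℂ).HasTraversals (k x ρ R) x ρ R}
        ≤ 1 := law_le_one _ _ _ _ _
      _ ≤ ENNReal.ofReal (M ^ 3 * (ρ / R) ^ 3) := ENNReal.one_le_ofReal.2 hbig

/-! ## Composition (sorry-free) -/

/-- **`FKGToTraversalBound` from the stubs.**  PA feeds excursion domination (stub 1); with the
random-walk collar bound (stub 2) the proved glue gives the SAW collar bound; the Kemppainen–Smirnov
iteration (stub 3) turns it into per-shell tightness at some modulus `M` for good approximations, the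
residual stub 4 supplies the other approximations at the same `M`, and the proved quantile reduction
assembles (H1). -/
theorem FKGToTraversalBound_of : FKGToTraversalBound := by
  intro hPA
  obtain ⟨M, hM, hgood⟩ :=
    stub_shellIteration (sawCollarBound_of (stub_excursionDomination hPA) stub_rwCollarBound)
  refine traversalBound_of_shellTight hM fun D a b hab => ?_
  by_cases hG : GoodApprox D a b
  · exact hgood D a b hab hG
  · exact stub_residualShells M hM D a b hab hG

end Summit.CriticalPhenomena.SAWScalingLimit.Cruxes.FKGToTraversalBound.ExcursionDomination

end
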